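import Literature.Probability.Percolation.CriticalContinuity
import Literature.Probability.Percolation.PercolationEvents
import Mathlib.Combinatorics.SimpleGraph.Metric
import HarnessLib

/-!
# Basu–Sapozhnikov 2017: Kesten's incipient infinite cluster from uniqueness and quasi-multiplicativity

Topic `Literature/Probability/Percolation` (namespace `Literature.Probability.Percolation`).
NAMED FACT (no proof in tree) vendoring

* D. Basu, A. Sapozhnikov, *Kesten's incipient infinite cluster and quasi-multiplicativity of crossing
  probabilities*, Electron. Commun. Probab. 22 (2017), paper no. 26 = arXiv:1603.06884, **Theorem 1.1**
  (§1, p. 3 of the arXiv text, read 2026-08-20), key `BasuSapozhnikov2017ECP`.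

Setting (§1, verbatim up to notation): `G` an infinite connected bounded-degree graph with vertex set `V`,
graph metric `ρ`; `B(v,n) = {x : ρ(v,x) ≤ n}`, `S(v,n) = {x : ρ(v,x) = n}`, `A(v,m,n) = B(v,n) ∖ B(v,m-1)`;
Bernoulli bond percolation `ℙ_p`; `p_c = inf{p : ℙ_p[|C(v)| = ∞] > 0}`; "`x ↔ y` in `Z`" = an open
nearest-neighbour path all of whose vertices lie in `Z`; `X ↔ Y in Z` iff some `x ∈ X`, `y ∈ Y` are so
joined.
> **(A1)** For any `p ∈ [0,1]` there exists almost surely at most one infinite open cluster.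
> **(A2)** Let `v ∈ V` and `δ > 0`.  There exists `ϰ > 0` such that for any `p ∈ [p_c, p_c+δ]`, integer `m > 0`,
> a finite connected set `Z ⊂ V` such that `Z ⊇ A(v,m,4m)`, and sets `X ⊂ Z ∩ B(v,m)` and `Y ⊂ Z ∖ B(v,4m)`,
> `ℙ_p[X ↔ Y in Z] ≥ ϰ · ℙ_p[X ↔ S(v,2m) in Z] · ℙ_p[Y ↔ S(v,2m) in Z]`.
> **Theorem 1.1.** Assume that the graph `G` satisfies (A1) and (A2) for some choice of `v ∈ V` and `δ > 0`.  Then,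
> for any cylinder event `E`, the two limits `lim_{n→∞} ℙ_{p_c}[E | w ↔ S(w,n)]` and
> `lim_{p↘p_c} ℙ_p[E | |C(w)| = ∞]` exist and have the same value.
> If the assumptions (A1) and (A2) are satisfied at `p = p_c`, then the first limit exists.

This file states the LAST sentence (the critical case), which is what an incipient-infinite-cluster
construction on `ℤ³` needs: (A1) holds on `ℤ^d` (tree: uniqueness), so on `ℤ³` Kesten's IIC limit is conditional
on the single open postulate (A2) at `p_c` (the authors "believe that assumption (A2) holds for lattices `ℤ^d` if
`d < 6`, but does not hold if `d > 6`", p. 4).  Vocabulary of the tree: `bondPercolation G p`, `criticalProb G v`,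
`openConn`, `openConnIn`, `percolatesAt`, `DeterminedBy` (cylinder events), Mathlib's graph metric `SimpleGraph.dist`.
The conditional probability is written as the ratio `ℙ[E ∩ {w ↔ S(w,n)}] / ℙ[w ↔ S(w,n)]`.

Consumers: LANE 3 / LANE 4 of the post-continuity programme (run/shared/lean/prim/rsw3/LANE4-READINESS.md); the lane's
`ℓ^∞`-box rendering of (A2) on `ℤ^d` is `Summit.CriticalPhenomena.PercolationContinuityZ3.Theorems.Crossing.SetToSetQuasiMultAt`.
-/

noncomputable section

namespace Literature.Probability.Percolation

open MeasureTheory Filter Topology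

/-- **Basu–Sapozhnikov's quasi-multiplicativity (A2) at parameter `p` with constant `ϰ`, around `v`** (graph-metric
balls `B(v,n) = {x : dist v x ≤ n}`, spheres `S(v,n) = {x : dist v x = n}`): for every `m ≥ 1`, every finite `Z`
inducing a connected subgraph and containing the annulus `A(v,m,4m) = {x : m ≤ dist v x ≤ 4m}`, all
`X ⊆ Z ∩ B(v,m)`, `Y ⊆ Z ∖ B(v,4m)`:
`ϰ · ℙ_p[X ↔ S(v,2m) in Z] · ℙ_p[Y ↔ S(v,2m) in Z] ≤ ℙ_p[X ↔ Y in Z]`.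
[cite: BasuSapozhnikov2017ECP, §1 assumption (A2)] -/
def BasuSapozhnikovQM {V : Type*} [Countable V] (G : SimpleGraph V) (v : V) (p : unitInterval) (ϰ : ℝ) : Prop :=
  ∀ m : ℕ, 1 ≤ m → ∀ Z : Finset V, (G.induce (↑Z : Set V)).Connected →
    {x : V | m ≤ G.dist v x ∧ G.dist v x ≤ 4 * m} ⊆ (↑Z : Set V) →
    ∀ X : Finset V, (↑X : Set V) ⊆ (↑Z : Set V) ∩ {x | G.dist v x ≤ m} →
    ∀ Y : Finset V, (↑Y : Set V) ⊆ (↑Z : Set V) \ {x | G.dist v x ≤ 4 * m} →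
      ϰ * (bondPercolation G p).real {ω | ∃ x ∈ X, ∃ s : V, G.dist v s = 2 * m ∧ ω ∈ openConnIn (↑Z : Set V) x s} *
          (bondPercolation G p).real {ω | ∃ y ∈ Y, ∃ s : V, G.dist v s = 2 * m ∧ ω ∈ openConnIn (↑Z : Set V) y s} ≤
        (bondPercolation G p).real {ω | ∃ x ∈ X, ∃ y ∈ Y, ω ∈ openConnIn (↑Z : Set V) x y}

/-- **Basu–Sapozhnikov 2017, Theorem 1.1 (critical case).**  Let `G` be an infinite, connected graph of bounded
degree and `v` a vertex.  If (A1) [for every `p`, almost surely at most one infinite open cluster] and (A2) at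
`p = p_c(G, v)` [`BasuSapozhnikovQM G v p_c ϰ` for some `ϰ > 0`] hold, then for every vertex `w` and every cylinder
event `E` (measurable, determined by finitely many edges) the limit
`lim_{n→∞} ℙ_{p_c}[E | w ↔ S(w,n)]` exists (written as the ratio `ℙ_{p_c}[E ∩ {w ↔ S(w,n)}] / ℙ_{p_c}[w ↔ S(w,n)]`) —
Kesten's incipient-infinite-cluster measure.  Statement only; the tree has no proof.  On `ℤ³` (A1) is a theorem, so the
IIC is conditional on (A2) at `p_c` alone. [cite: BasuSapozhnikov2017ECP, Thm. 1.1] -/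
def BasuSapozhnikov2017_thm_1_1_critical : Prop :=
  ∀ (V : Type) [DecidableEq V] [Countable V] (G : SimpleGraph V) [G.LocallyFinite],
    G.Connected → Infinite V → (∃ D : ℕ, ∀ x : V, G.degree x ≤ D) →
    ∀ v : V,
      (∀ p : unitInterval, ∀ᵐ ω ∂(bondPercolation G p),
          ∀ x y : V, ω ∈ percolatesAt x → ω ∈ percolatesAt y → (openGraph ω).Reachable x y) →
      (∃ ϰ : ℝ, 0 < ϰ ∧ BasuSapozhnikovQM G v ⟨criticalProb G v, criticalProb_mem_Icc G v⟩ ϰ) →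
      ∀ (w : V) (E : Set (BondConfig V)) (F : Finset (Sym2 V)), MeasurableSet E → DeterminedBy E (↑F : Set (Sym2 V)) →
        ∃ ν : ℝ, Tendsto
          (fun n : ℕ =>
            (bondPercolation G ⟨criticalProb G v, criticalProb_mem_Icc G v⟩).real
                (E ∩ {ω | ∃ s : V, G.dist w s = n ∧ ω ∈ openConn w s}) /
              (bondPercolation G ⟨criticalProb G v, criticalProb_mem_Icc G v⟩).real
                {ω | ∃ s : V, G.dist w s = n ∧ ω ∈ openConn w s})
          atTop (𝓝 ν)

end Literature.Probability.Percolation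

end
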